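import Literature.Probability.LatticeModels.FermionicObservableSums
import Literature.Probability.LatticeModels.InterfaceRearrangement
import HarnessLib

/-!
# Touch criterion, combinatorial half: orbit dichotomy; right faces reach the exit face

Crux `LagHandOff` (line hitting-tournament), stubs C and D-C. For admissible Dobrushin data `E`
and the completed configuration `β = E.bcBondConfig ω` (turning rule `nextCorner β`, orbit
`cornerOrbit β`, start corner `startCorner hE`, exit time `exitTime hE ω`):
`stub_touch_orbit_dichotomy` — a corner with inner face whose vertex is on the arc `A` or on an
open edge is on the chordal exploration or on a cycle of inner corners (left-vertex invariant and
exit analysis along its own orbit, uniqueness of the exit corner, injectivity of the turning rule,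
finiteness of the inner corners); `stub_touch_rightFace_dualReachable_exit` — every face of the
chordal exploration is joined to the exit face by dual-open dual edges (one closed edge per turn).
-/

noncomputable section

open Set
open Literature.Probability.Percolation Literature.Probability.LatticeModels

namespace Summit.CriticalPhenomena.CardyFormulaZ2.Cruxes.LagHandOff.HittingTournament

variable {β : BondConfig (Site 2)} {E : DiscreteDobrushin} {ω : BondConfig (Site 2)}

/-! ### Iterates of the turning rule -/

/-- The orbit from an orbit point: `orb_c (a + b) = orb_{orb_c a} b`. -/
private theorem cornerOrbit_add (c : Site 2 × Fin 4) (a b : ℕ) :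
    cornerOrbit β c (a + b) = cornerOrbit β (cornerOrbit β c a) b := by
  induction b with
  | zero => rfl
  | succ b ih =>
    rw [Nat.add_succ]
    change nextCorner β _ = nextCorner β _
    rw [ih]

/-- The `b`-th iterate of the (injective) turning rule is injective. -/
private theorem eq_of_cornerOrbit_eq (b : ℕ) {c c' : Site 2 × Fin 4}
    (h : cornerOrbit β c b = cornerOrbit β c' b) : c = c' := by
  induction b with
  | zero => exact h
  | succ b ih => exact ih (nextCorner_injective h)

/-! ### The orbit from a corner satisfying the left-vertex invariant -/

/-- The left-vertex invariant (vertex on the arc `A` or on an open edge) propagates along the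
orbit of the turning rule from any corner satisfying it (cf. `cornerOrbit_inv`). -/
private theorem cornerOrbit_inv_of_inv {p : Site 2 × Fin 4}
    (hp : p.1 ∈ E.zdArcA ∨ ∃ e ∈ E.bcBondConfig ω, p.1 ∈ e) (n : ℕ) :
    (cornerOrbit (E.bcBondConfig ω) p n).1 ∈ E.zdArcA ∨
      ∃ e ∈ E.bcBondConfig ω, (cornerOrbit (E.bcBondConfig ω) p n).1 ∈ e := by
  induction n with
  | zero => exact hp
  | succ n ih =>
    rw [cornerOrbit_succ]
    by_cases h : cTgt (cornerOrbit (E.bcBondConfig ω) p n) ∈ E.bcBondConfig ω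
    · rw [nextCorner_of_mem h]
      exact Or.inr ⟨_, h, Sym2.mem_mk_right _ _⟩
    · rw [nextCorner_of_not_mem h]
      exact ih

/-- Exit analysis at a corner satisfying the left-vertex invariant (cf. `cornerOrbit_exit`): if
its face is inner and the face of its successor is not, the target edge is closed, targeted at
its `A`-end, with other endpoint on the arc `B` — the corner is the exit corner. -/
private theorem isExitCorner_of_inv (hE : E.IsZdAdmissible) {r : Site 2 × Fin 4}
    (hinv : r.1 ∈ E.zdArcA ∨ ∃ e ∈ E.bcBondConfig ω, r.1 ∈ e)
    (hin : E.IsInnerFace (cFace r))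
    (hout : ¬ E.IsInnerFace (cFace (nextCorner (E.bcBondConfig ω) r))) : E.IsExitCorner r := by
  have hclosed : cTgt r ∉ E.bcBondConfig ω := fun h =>
    hout (by rwa [cFace_nextCorner_of_mem h])
  have hIn : E.IsInEdge r.1 (r.2 + 1) := by
    refine ⟨by rw [fin4_add_one_add_three]; exact hin, ?_⟩
    rwa [cFace_nextCorner_of_not_mem hclosed] at hout
  obtain ⟨h1, h2⟩ := hE.arcs_cover_faceBoundary hIn.isFaceBoundaryEdge
  have hA : r.1 ∈ E.zdArcA := DiscreteDobrushin.mem_zdArcA_of_inv hE hinv h1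
  refine ⟨hA, ?_, hIn⟩
  rcases h2 with h2 | h2
  · refine absurd (DiscreteDobrushin.mem_bcBondConfig_of_arcA hIn.isFaceBoundaryEdge.1 ?_) hclosed
    intro x hx
    rcases Sym2.mem_iff.1 hx with rfl | rfl
    · exact hA
    · exact h2
  · exact h2

/-- **C: orbit dichotomy.** For admissible Dobrushin data, a coded corner `p` with inner face
whose vertex lies on the arc `A` or on an open edge of the completed configuration is either a
corner of the chordal exploration (the orbit of the start corner up to its exit time), or lies
on a cycle of the turning rule through corners with inner faces (given with its minimal period
`n + 1`). Proof: if the orbit from `p` ever reaches a non-inner face, the corner just before is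
the exit corner (`isExitCorner_of_inv`, `IsExitCorner.eq`), which the chordal exploration also
reaches at time `exitTime - 1`; walking back with the injective turning rule, either `p` is met
on the chordal path or the start corner would have an inner predecessor (`nextCorner_ne_start`).
Otherwise the orbit stays in the finite set of inner corners and is periodic. -/
theorem stub_touch_orbit_dichotomy :
    ∀ (E : DiscreteDobrushin) (hE : E.IsZdAdmissible) (ω : BondConfig (Site 2))
      (p : Site 2 × Fin 4), E.IsInnerFace (cFace p) →
      (p.1 ∈ E.zdArcA ∨ ∃ e ∈ E.bcBondConfig ω, p.1 ∈ e) →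
      (∃ m ≤ DiscreteDobrushin.exitTime hE ω,
          cornerOrbit (E.bcBondConfig ω) (DiscreteDobrushin.startCorner hE) m = p) ∨
        ∃ n : ℕ, cornerOrbit (E.bcBondConfig ω) p (n + 1) = p ∧
          (∀ j, 1 ≤ j → j ≤ n → cornerOrbit (E.bcBondConfig ω) p j ≠ p) ∧
          ∀ j ≤ n, E.IsInnerFace (cFace (cornerOrbit (E.bcBondConfig ω) p j)) := by
  intro E hE ω p hpin hpinv
  classical
  have hc₀ := DiscreteDobrushin.isStartCorner_startCorner hE
  by_cases hex : ∃ m, ¬ E.IsInnerFace (cFace (cornerOrbit (E.bcBondConfig ω) p m))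
  · -- the orbit from `p` exits: it merges backwards with the chordal exploration
    left
    have hm := Nat.find_spec hex
    have hlt : ∀ j < Nat.find hex, E.IsInnerFace (cFace (cornerOrbit (E.bcBondConfig ω) p j)) :=
      fun j hj => not_not.1 (Nat.find_min hex hj)
    have hpos : 0 < Nat.find hex := by
      by_contra h0
      have h0' : Nat.find hex = 0 := by omega
      rw [h0'] at hm
      exact hm hpin
    obtain ⟨m, hmeq⟩ : ∃ m, Nat.find hex = m + 1 := ⟨Nat.find hex - 1, by omega⟩
    rw [hmeq] at hm hlt
    rw [cornerOrbit_succ] at hm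
    have h1 : E.IsExitCorner (cornerOrbit (E.bcBondConfig ω) p m) :=
      isExitCorner_of_inv hE (cornerOrbit_inv_of_inv hpinv m) (hlt m (Nat.lt_succ_self m)) hm
    obtain ⟨N, hN⟩ : ∃ N, DiscreteDobrushin.exitTime hE ω = N + 1 :=
      ⟨DiscreteDobrushin.exitTime hE ω - 1, by
        have := DiscreteDobrushin.exitTime_pos hE ω; omega⟩
    have h2 : E.IsExitCorner
        (cornerOrbit (E.bcBondConfig ω) (DiscreteDobrushin.startCorner hE) N) :=
      isExitCorner_cornerOrbit hE hc₀
        (DiscreteDobrushin.isInnerFace_of_lt_exitTime hE ω (by omega))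
        (by rw [← hN]; exact DiscreteDobrushin.not_isInnerFace_exitTime hE ω)
    have heq : cornerOrbit (E.bcBondConfig ω) p m =
        cornerOrbit (E.bcBondConfig ω) (DiscreteDobrushin.startCorner hE) N := h1.eq hE h2
    rcases le_or_gt m N with hmN | hNm
    · refine ⟨N - m, by omega, eq_of_cornerOrbit_eq (β := E.bcBondConfig ω) m ?_⟩
      rw [← cornerOrbit_add, Nat.sub_add_cancel hmN]
      exact heq.symm
    · exfalso
      obtain ⟨t, ht⟩ : ∃ t, t + 1 + N = m := ⟨m - N - 1, by omega⟩
      have key : cornerOrbit (E.bcBondConfig ω) p (t + 1) = DiscreteDobrushin.startCorner hE := by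
        refine eq_of_cornerOrbit_eq (β := E.bcBondConfig ω) N ?_
        rw [← cornerOrbit_add, ht, heq]
      rw [cornerOrbit_succ] at key
      exact nextCorner_ne_start hE hc₀ (hlt t (by omega)) key
  · -- the orbit from `p` never exits: it is a cycle of inner corners
    right
    push Not at hex
    obtain ⟨i, j, hij, hEq⟩ := (finite_innerCorners hE).exists_lt_map_eq_of_forall_mem
      (f := cornerOrbit (E.bcBondConfig ω) p) hex
    have hper : ∃ t, 0 < t ∧ cornerOrbit (E.bcBondConfig ω) p t = p := by
      refine ⟨j - i, by omega, eq_of_cornerOrbit_eq (β := E.bcBondConfig ω) i ?_⟩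
      rw [← cornerOrbit_add, Nat.sub_add_cancel hij.le]
      exact hEq.symm
    obtain ⟨hT0, hT⟩ := Nat.find_spec hper
    have hTmin : ∀ s, 0 < s → s < Nat.find hper → cornerOrbit (E.bcBondConfig ω) p s ≠ p :=
      fun s hs hsT h => Nat.find_min hper hsT ⟨hs, h⟩
    obtain ⟨n, hn⟩ : ∃ n, Nat.find hper = n + 1 := ⟨Nat.find hper - 1, by omega⟩
    rw [hn] at hT hTmin
    exact ⟨n, hT, fun j hj1 hjn => hTmin j hj1 (by omega), fun j _ => hex j⟩

/-! ### Right faces are dual-joined along the orbit -/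

/-- `k ≠ k + 1` in `Fin 4`. -/
private theorem fin4_ne_add_one (k : Fin 4) : k ≠ k + 1 := by revert k; decide

/-- The dual edge of the target edge of a coded corner joins its face to the next face
counter-clockwise around its vertex (both faces lie on it, `mem_dualEdge_cornerTarget` /
`mem_dualEdge_cornerSource`, and they differ). -/
private theorem dualEdge_cTgt_eq (q : Site 2 × Fin 4) :
    dualEdge (cTgt q) = s(cFace q, faceAt q.1 (q.2 + 1)) := by
  have h₁ : cFace q ∈ dualEdge (cTgt q) := by
    rw [← cornerTarget_cFace]
    exact mem_dualEdge_cornerTarget (isCorner_cFace q)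
  have h₂ : faceAt q.1 (q.2 + 1) ∈ dualEdge (cTgt q) := by
    have : cTgt q = cSrc (q.1, q.2 + 1) := rfl
    rw [this, ← cornerSource_cFace]
    exact mem_dualEdge_cornerSource (isCorner_cFace (q.1, q.2 + 1))
  have hne : cFace q ≠ faceAt q.1 (q.2 + 1) := fun h =>
    fin4_ne_add_one q.2 (faceAt_injective q.1 h)
  exact (Sym2.mem_and_mem_iff hne).1 ⟨h₁, h₂⟩

/-- One step of the orbit, seen from the right: the face of the successor corner is the same
face (open target edge, followed) or the next face around the vertex across the closed target
edge, whose dual edge is then dual-open (`dualEdge_mem_dualConfig_of_not_mem`). -/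
private theorem reachable_cFace_nextCorner (q : Site 2 × Fin 4) :
    (openGraph (dualConfig (E.bcBondConfig ω))).Reachable (cFace q)
      (cFace (nextCorner (E.bcBondConfig ω) q)) := by
  by_cases h : cTgt q ∈ E.bcBondConfig ω
  · rw [cFace_nextCorner_of_mem h]
  · rw [cFace_nextCorner_of_not_mem h]
    refine SimpleGraph.Adj.reachable ?_
    rw [openGraph_adj]
    refine ⟨?_, fun heq => fin4_ne_add_one q.2 (faceAt_injective q.1 heq)⟩
    have := DiscreteDobrushin.dualEdge_mem_dualConfig_of_not_mem (cTgt_mem_edgeSet q) h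
    rwa [dualEdge_cTgt_eq] at this

/-- Every face along an orbit of the turning rule is dual-joined to the face of its start. -/
private theorem reachable_cFace_cornerOrbit_of (c : Site 2 × Fin 4) (n : ℕ) :
    (openGraph (dualConfig (E.bcBondConfig ω))).Reachable (cFace c)
      (cFace (cornerOrbit (E.bcBondConfig ω) c n)) := by
  induction n with
  | zero => exact SimpleGraph.Reachable.refl _
  | succ n ih =>
    rw [cornerOrbit_succ]
    exact ih.trans (reachable_cFace_nextCorner _)

/-- **D-C: every right face of the chordal exploration is dual-joined to the exit face.** For
`m ≤ exitTime`, the face of the `m`-th corner of the orbit of the start corner is joined to the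
(non-inner) face of the corner at the exit time by a walk of dual edges of
`dualConfig (E.bcBondConfig ω)`: along the orbit the face only changes across a closed target
edge, whose dual edge is dual-open and joins the two faces. -/
theorem stub_touch_rightFace_dualReachable_exit :
    ∀ (E : DiscreteDobrushin) (hE : E.IsZdAdmissible) (ω : BondConfig (Site 2)) (m : ℕ),
      m ≤ DiscreteDobrushin.exitTime hE ω →
      (openGraph (dualConfig (E.bcBondConfig ω))).Reachable
        (cFace (cornerOrbit (E.bcBondConfig ω) (DiscreteDobrushin.startCorner hE) m))
        (cFace (cornerOrbit (E.bcBondConfig ω) (DiscreteDobrushin.startCorner hE)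
          (DiscreteDobrushin.exitTime hE ω))) := by
  intro E hE ω m hm
  have key := reachable_cFace_cornerOrbit_of (E := E) (ω := ω)
    (cornerOrbit (E.bcBondConfig ω) (DiscreteDobrushin.startCorner hE) m)
    (DiscreteDobrushin.exitTime hE ω - m)
  rwa [← cornerOrbit_add, Nat.add_sub_of_le hm] at key

end Summit.CriticalPhenomena.CardyFormulaZ2.Cruxes.LagHandOff.HittingTournament

end
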